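import Summits.ABC.StewartYu.PadicW80ParD
import HarnessLib

/-!
# The `p`-adic Waldschmidt parameter record — part E (sequel of `PadicW80ParD`)

Support file (plain definitions and theorems; no named facts): continuation of the twin of
`Waldschmidt1980Params/ParamsB/Sizes/Numeric/Main` on the record `PadicW80Par`
(design, HOME/p1/WP-A4-table.md: `V_max` inside the logarithms `W⋆, G` and an ARBITRARY eliminated size
`1 ≤ V_el ≤ V_max` in `U` — p2's FLAG F-p2-3; `c_S = 2¹⁵` — the `p`-adic zeros-per-`𝔘` ratio; all names carry a
suffix `p` to keep them apart from the archimedean record `W80Par`). [cite: Waldschmidt1980, §3.2–3.5 (pp. 264–274)]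
-/

noncomputable section

open Finset Real
open Literature.NumberTheory.Transcendental Literature.NumberTheory.Transcendental.Waldschmidt1980

namespace Summit.ABC.StewartYu

namespace PadicW80Par

variable {d : ℕ} (P : PadicW80Par d)

/-- `∑ⱼ ⌊Lⱼ/2^{J₀}⌋ ≤ 4 m V_θ` (real): `Lⱼ ≤ (2L_θ+2)V_θ`, `2^{J₀} > L_θ`. [folklore] -/
theorem sum_L_div_le : ((∑ j, P.Lp j / 2 ^ P.J₀p : ℕ) : ℝ) ≤ 4 * mRp d * P.Vel := by
  have hLθ := P.Lθ_ge
  have hden := P.den_Lθ_pos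
  have hL1 : (1 : ℝ) ≤ P.Lθp := by exact_mod_cast P.one_le_Lθ
  have hJ : (P.Lθp : ℝ) < (2 : ℝ) ^ P.J₀p := by exact_mod_cast P.Lθ_lt_two_pow
  have hVθ := P.one_le_Vθ
  have hj : ∀ j, ((P.Lp j / 2 ^ P.J₀p : ℕ) : ℝ) ≤ 4 * P.Vel := by
    intro j
    have h1 : ((P.Lp j / 2 ^ P.J₀p : ℕ) : ℝ) ≤ (P.Lp j : ℝ) / 2 ^ P.J₀p := by
      have := Nat.cast_div_le (α := ℝ) (m := P.Lp j) (n := 2 ^ P.J₀p); push_cast at this; exact this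
    have h0 : 0 < cLp' * mRp d * 2 ^ (d + 2) * (P.S₀p : ℝ) := by unfold cLp'; have := mR_pos P; have := P.S₀_pos; positivity
    have hVj := P.hV j
    have hU := P.U_pos
    have hLj : (P.Lp j : ℝ) ≤ P.Up / (cLp' * mRp d * 2 ^ (d + 2) * P.S₀p * P.Vs j) := by
      unfold Lp; exact Nat.floor_le (div_nonneg hU.le (by positivity))
    have h3 : P.Up / (cLp' * mRp d * 2 ^ (d + 2) * P.S₀p * P.Vs j) ≤ P.Up / (cLp' * mRp d * 2 ^ (d + 2) * P.S₀p * P.Vel) * P.Vel := by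
      have h3a : P.Up / (cLp' * mRp d * 2 ^ (d + 2) * P.S₀p * P.Vs j) ≤ P.Up / (cLp' * mRp d * 2 ^ (d + 2) * P.S₀p) :=
        div_le_div_of_nonneg_left hU.le h0 (le_mul_of_one_le_right h0.le hVj)
      have h3b : P.Up / (cLp' * mRp d * 2 ^ (d + 2) * P.S₀p) = P.Up / (cLp' * mRp d * 2 ^ (d + 2) * P.S₀p * P.Vel) * P.Vel := by
        field_simp
      rw [← h3b]; exact h3a
    have h5 : (P.Lp j : ℝ) ≤ (2 * P.Lθp + 2) * P.Vel := hLj.trans (h3.trans (by nlinarith))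
    have h6 : (P.Lp j : ℝ) / 2 ^ P.J₀p ≤ (2 * P.Lθp + 2) * P.Vel / P.Lθp := by
      calc (P.Lp j : ℝ) / 2 ^ P.J₀p ≤ (P.Lp j : ℝ) / P.Lθp := div_le_div_of_nonneg_left (Nat.cast_nonneg _) (by linarith) hJ.le
        _ ≤ (2 * P.Lθp + 2) * P.Vel / P.Lθp := div_le_div_of_nonneg_right h5 (by linarith)
    have h7 : (2 * P.Lθp + 2) * P.Vel / P.Lθp ≤ 4 * P.Vel := by
      rw [div_le_iff₀ (by linarith)]; nlinarith
    linarith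
  push_cast
  calc ∑ j, ((P.Lp j / 2 ^ P.J₀p : ℕ) : ℝ) ≤ ∑ _j : Fin d, 4 * P.Vel := sum_le_sum fun j _ => hj j
    _ = d * (4 * P.Vel) := by simp
    _ ≤ 4 * mRp d * P.Vel := by unfold mRp; nlinarith

/-- `T/2^{J₀} ≥ 2¹⁰ m² V_θ − 1` (real). [folklore] -/
theorem T_div_ge : (2 : ℝ) ^ 10 * mRp d ^ 2 * P.Vel - 1 ≤ ((P.Tp / 2 ^ P.J₀p : ℕ) : ℝ) := by
  have h1 : (P.Tp : ℝ) / ((2 ^ P.J₀p : ℕ) : ℝ) - 1 ≤ ((P.Tp / 2 ^ P.J₀p : ℕ) : ℝ) := by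
    have hb : 0 < 2 ^ P.J₀p := Nat.pow_pos two_pos
    have h := Nat.lt_div_mul_add hb (a := P.Tp)
    have hb' : (0 : ℝ) < ((2 ^ P.J₀p : ℕ) : ℝ) := by exact_mod_cast hb
    rw [div_sub_one hb'.ne', div_le_iff₀ hb']
    have : (P.Tp : ℝ) < (P.Tp / 2 ^ P.J₀p : ℕ) * ((2 ^ P.J₀p : ℕ) : ℝ) + ((2 ^ P.J₀p : ℕ) : ℝ) := by
      exact_mod_cast h
    linarith
  push_cast at h1
  have h2 := P.T_ge_Lθ
  have h3 : ((2 : ℝ) ^ P.J₀p) ≤ 2 * P.Lθp := by exact_mod_cast P.two_pow_le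
  have hL1 : (1 : ℝ) ≤ P.Lθp := by exact_mod_cast P.one_le_Lθ
  have h4 : (2 : ℝ) ^ 10 * mRp d ^ 2 * P.Vel ≤ (P.Tp : ℝ) / 2 ^ P.J₀p := by
    rw [le_div_iff₀ (by positivity)]
    calc (2 : ℝ) ^ 10 * mRp d ^ 2 * P.Vel * 2 ^ P.J₀p ≤ 2 ^ 10 * mRp d ^ 2 * P.Vel * (2 * P.Lθp) := by
          have := P.one_le_Vθ; gcongr
      _ = 2 ^ 11 * mRp d ^ 2 * P.Vel * P.Lθp := by ring
      _ ≤ P.Tp := h2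
  linarith

/-- **The numbers of the endgame**: `∑ⱼ ⌊Lⱼ/2^{J₀}⌋ + 1 ≤ ⌊T/2^{J₀}⌋` and
`h L_b < (⌊T/2^{J₀}⌋ − ∑ⱼ ⌊Lⱼ/2^{J₀}⌋) · #{odd s < 2^{J₀} S₀}` (the latter is `≥ m 𝔘/128`, the
former `≤ 𝔘/c_L + 3W⋆`). [cite: Waldschmidt1980, §3.5 (p. 274)] -/
theorem endgame_numbers :
    (∑ j, P.Lp j / 2 ^ P.J₀p) + 1 ≤ P.Tp / 2 ^ P.J₀p ∧
      P.hparp * P.Lbp < (P.Tp / 2 ^ P.J₀p - ∑ j, P.Lp j / 2 ^ P.J₀p) * ((range (2 ^ P.J₀p * P.S₀p)).filter Odd).card := by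
  have hsum := P.sum_L_div_le
  have hTd := P.T_div_ge
  have hm := two_le_mR P; have hm0 := mR_pos P; have hVθ := P.one_le_Vθ; have hW := P.one_le_Wstar
  have hU := P.𝔘_pos
  -- (1) the first claim, in the reals
  have h1real : ((∑ j, P.Lp j / 2 ^ P.J₀p : ℕ) : ℝ) + 1 ≤ ((P.Tp / 2 ^ P.J₀p : ℕ) : ℝ) := by
    have : 4 * mRp d * P.Vel + 1 ≤ (2 : ℝ) ^ 10 * mRp d ^ 2 * P.Vel - 1 := by nlinarith
    linarith
  have h1 : (∑ j, P.Lp j / 2 ^ P.J₀p) + 1 ≤ P.Tp / 2 ^ P.J₀p := by exact_mod_cast h1real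
  refine ⟨h1, ?_⟩
  -- (2) the second claim
  rw [P.card_odd_eq]
  have hsub : (((P.Tp / 2 ^ P.J₀p - ∑ j, P.Lp j / 2 ^ P.J₀p : ℕ)) : ℝ) = ((P.Tp / 2 ^ P.J₀p : ℕ) : ℝ) - ((∑ j, P.Lp j / 2 ^ P.J₀p : ℕ) : ℝ) := by
    rw [Nat.cast_sub (by omega)]
  have hT' : (2 : ℝ) ^ 9 * mRp d ^ 2 * P.Vel ≤ ((P.Tp / 2 ^ P.J₀p - ∑ j, P.Lp j / 2 ^ P.J₀p : ℕ) : ℝ) := by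
    rw [hsub]; nlinarith
  -- `#odd = 2^{J₀} ⌊c_S m W⋆⌋ ≥ Lθ (c_S m W⋆ − 1) ≥ Lθ c_S m W⋆ / 2`
  have hfl : cSp * mRp d * P.Wstarp - 1 ≤ (⌊cSp * mRp d * P.Wstarp⌋₊ : ℝ) := by
    have := Nat.lt_floor_add_one (cSp * mRp d * P.Wstarp); linarith
  have hcS := P.cS_mul_ge
  have hJ : (P.Lθp : ℝ) ≤ (2 : ℝ) ^ P.J₀p := by exact_mod_cast P.Lθ_lt_two_pow.le
  have hodd : (P.Lθp : ℝ) * (cSp * mRp d * P.Wstarp / 2) ≤ ((2 ^ P.J₀p * ⌊cSp * mRp d * P.Wstarp⌋₊ : ℕ) : ℝ) := by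
    push_cast
    have h2 : cSp * mRp d * P.Wstarp / 2 ≤ (⌊cSp * mRp d * P.Wstarp⌋₊ : ℝ) := by linarith
    exact mul_le_mul hJ h2 (by linarith) (by positivity)
  -- `Lθ Vθ ≥ 𝔘/(8 c_L' c_S m² W⋆)`
  have hLθ := P.Lθ_ge
  have hS := P.S₀_le; have hS0 := P.S₀_pos
  have hLV : P.𝔘p / (8 * cLp' * cSp * mRp d ^ 2 * P.Wstarp) ≤ (P.Lθp : ℝ) * P.Vel := by
    have hden := P.den_Lθ_pos
    have e : P.Up / (cLp' * mRp d * 2 ^ (d + 2) * P.S₀p * P.Vel) / 2 = P.𝔘p / (4 * cLp' * mRp d * P.S₀p * P.Vel) := by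
      rw [P.U_eq, pow_succ]; field_simp; ring
    rw [e] at hLθ
    have h2 : P.𝔘p / (8 * cLp' * cSp * mRp d ^ 2 * P.Wstarp) ≤ P.𝔘p / (4 * cLp' * mRp d * P.S₀p * P.Vel) * P.Vel := by
      rw [div_mul_eq_mul_div, div_le_div_iff₀ (by unfold cLp' cSp; positivity) (by unfold cLp'; positivity)]
      -- `𝔘 (4 c_L' m S₀ Vθ) ≤ 𝔘 Vθ (8 c_L' c_S m² W⋆)` iff `S₀ ≤ 2 c_S m W⋆`
      have : 4 * cLp' * mRp d * (P.S₀p : ℝ) ≤ 8 * cLp' * cSp * mRp d ^ 2 * P.Wstarp := by unfold cLp' cSp at *; nlinarith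
      have h0 : 0 ≤ P.𝔘p * P.Vel := by positivity
      nlinarith
    calc P.𝔘p / (8 * cLp' * cSp * mRp d ^ 2 * P.Wstarp) ≤ P.𝔘p / (4 * cLp' * mRp d * P.S₀p * P.Vel) * P.Vel := h2
      _ ≤ (P.Lθp : ℝ) * P.Vel := mul_le_mul_of_nonneg_right hLθ (by linarith)
  -- assemble in the reals
  have hlhs := P.hparLb_le
  have hWU := P.Wstar_le_𝔘
  suffices key : (P.hparp : ℝ) * P.Lbp < ((P.Tp / 2 ^ P.J₀p - ∑ j, P.Lp j / 2 ^ P.J₀p : ℕ) : ℝ) * ((2 ^ P.J₀p * ⌊cSp * mRp d * P.Wstarp⌋₊ : ℕ) : ℝ) by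
    exact_mod_cast key
  have hprod : (2 : ℝ) ^ 9 * mRp d ^ 2 * P.Vel * ((P.Lθp : ℝ) * (cSp * mRp d * P.Wstarp / 2)) ≤
      ((P.Tp / 2 ^ P.J₀p - ∑ j, P.Lp j / 2 ^ P.J₀p : ℕ) : ℝ) * ((2 ^ P.J₀p * ⌊cSp * mRp d * P.Wstarp⌋₊ : ℕ) : ℝ) :=
    by
      have hc : (0 : ℝ) < cSp := by unfold cSp; norm_num
      have h0 : (0 : ℝ) ≤ cSp * mRp d * P.Wstarp / 2 := by positivity
      exact mul_le_mul hT' hodd (mul_nonneg (Nat.cast_nonneg _) h0) (Nat.cast_nonneg _)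
  refine lt_of_lt_of_le ?_ hprod
  -- `2^9 m² Vθ Lθ c_S m W⋆/2 ≥ 2^8 c_S m³ W⋆ · 𝔘/(8 c_L' c_S m² W⋆) = 32 m 𝔘/c_L' ≥ 𝔘/64 > 𝔘/c_L + 3 W⋆`
  have h32 : P.𝔘p / 64 ≤ (2 : ℝ) ^ 9 * mRp d ^ 2 * P.Vel * ((P.Lθp : ℝ) * (cSp * mRp d * P.Wstarp / 2)) := by
    have e : (2 : ℝ) ^ 9 * mRp d ^ 2 * P.Vel * ((P.Lθp : ℝ) * (cSp * mRp d * P.Wstarp / 2)) =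
        (2 ^ 8 * cSp * mRp d ^ 3 * P.Wstarp) * ((P.Lθp : ℝ) * P.Vel) := by ring
    rw [e]
    have h0 : (0 : ℝ) ≤ 2 ^ 8 * cSp * mRp d ^ 3 * P.Wstarp := by unfold cSp; positivity
    calc P.𝔘p / 64 ≤ (2 ^ 8 * cSp * mRp d ^ 3 * P.Wstarp) * (P.𝔘p / (8 * cLp' * cSp * mRp d ^ 2 * P.Wstarp)) := by
          unfold cLp' cSp
          rw [mul_div_assoc', le_div_iff₀ (by positivity)]
          have h0' : 0 ≤ mRp d ^ 2 * P.Wstarp * P.𝔘p := by positivity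
          have h2m := mul_le_mul_of_nonneg_left hm h0'
          calc P.𝔘p / 64 * (8 * (2 : ℝ) ^ 12 * 2 ^ 15 * mRp d ^ 2 * P.Wstarp) = 2 ^ 24 * (mRp d ^ 2 * P.Wstarp * P.𝔘p) := by ring
            _ ≤ 2 ^ 23 * (mRp d * (mRp d ^ 2 * P.Wstarp * P.𝔘p)) := by nlinarith
            _ = 2 ^ 8 * 2 ^ 15 * mRp d ^ 3 * P.Wstarp * P.𝔘p := by ring
      _ ≤ (2 ^ 8 * cSp * mRp d ^ 3 * P.Wstarp) * ((P.Lθp : ℝ) * P.Vel) := mul_le_mul_of_nonneg_left hLV h0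
  have : P.𝔘p / cLp + 3 * P.Wstarp < P.𝔘p / 64 := by unfold cLp; nlinarith
  linarith


end PadicW80Par

end Summit.ABC.StewartYu

end
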